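import Literature.MathematicalPhysics.QuantumFieldTheory.Balaban1983to89.B4ThmRegionPairEta
import Literature.MathematicalPhysics.QuantumFieldTheory.Balaban1983to89.B4Cor23RegionDelta
import Literature.MathematicalPhysics.QuantumFieldTheory.Balaban1983to89.B4ConstantsWindow

/-!
# `Balaban1983to89.B4Cor23RegionPairFam` — [Balaban1983RegularityDecay] COROLLARY 2.3 (2.30) AND ITS `δG` CLAUSE,
# pp. 580–581, ON THE FAMILY OF GENERAL REGION PAIRS `Ω ⊂ Ω₀ ⊂ ηℤ^{d+1}` AT A (1.7)-REGULAR FIELD —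
# `cor23Printed_regionPairFam : B4.Cor23Printed (regionPairFam F d ℓ a₋ a₊ m²₊ c β K)`

statement-level skeleton of published theorems with citation tags; proofs where landed; nothing here is a claim about the Yang–Mills mass gap

CITATION HEADER.  T. Bałaban, *Regularity and decay of lattice Green's functions*, Commun. Math. Phys. **89** (1983)
571–597, doi:10.1007/bf01214744 [Balaban1983RegularityDecay] (cell paper B4; held text
`paper:balaban1983-cmp89-regularity-decay`, journal page = PDF page + 570; pp. 580–581 [PDF 10–11]).  Unit
`lit-balaban-r01` gen 10 (B4 fold owner; HOME `run/shared/lean/pub/lit-balaban/`), SKELETON row **B4.Cor2.3** — file 1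
of the r01 g10 programme (THIS FILE → `B4Cor23TorusPairFam`, the torus clause of the row).

WHAT IS PRINTED.  pp. 580–581 [PDF 10–11], verbatim: «Corollary 2.3. If Ω and A are as in Proposition I.2.1, then there
exist positive constants c₀, δ₀ such that for arbitrary scalar field configurations f, f′ defined on Ω, we have
|⟨f, G_k(Ω,A)f′⟩|, |⟨f, D^η_{A,μ}G_k(Ω,A)f′⟩|, |⟨f, G_k(Ω,A)D^{η*}_{A,ν}f′⟩|, |⟨f, D^η_{A,μ}G_k(Ω,A)D^{η*}_{A,ν}f′⟩|
≤ c₀e^{−δ₀dist(supp f, supp f′)}‖f‖₂‖f′‖₂. (2.30)  The same inequalities hold for δG_k(Ω,Ω₀,A) with the additional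
factor e^{−δ₀(dist(supp f,Ω^c) + dist(supp f′,Ω^c))}. … Let us notice also that now there are no restrictions on supports
of f, f′».  «Ω and A as in Proposition I.2.1» = p. 572 «We consider subsets Ω which are unions of big blocks», p. 573
(1.7) «|(∂^η_μ A)(x)| ≤ ce^{β−1}», «for e sufficiently small»; p. 573 «constants … independent of A, k, Ω».

WHAT THIS MODULE PROVES.  The typed Corollary `B4.Cor23Printed` (module `B4`: `∃ c₀ δ₀ e₁ > 0, ∀ i, regular →
bigBlocks → 0 < e ≤ e₁ → (four G pairings) ∧ (four δG pairings)`) INHABITED on r01 g8's family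
`B4ThmRegionPairEta.regionPairFam F d ℓ a₋ a₊ m²₊ c β K` — the carrier of `thmPrintedNN_regionPairFam` (general nested
pairs `Ω ⊆ Ω₀` of finite unions of unit blocks in `ηℤ^{d+1}`, `η = L^{-k}`, running coefficient `a_k = B1.aSeq a L k`
with `a ∈ [a₋,a₊]`, `m² ∈ [0,m²₊]`, every component field `A` with (1.7) on `Ω₀`, every coupling):
**`cor23Printed_regionPairFam`**, with `c₀ = c1W(d, ¾a₋, a₂) + 6·c0R(¾a₋)`, `δ₀ = dW(d, ¾a₋, a₂)`
(`a₂ = max(a₊, ¾a₋)`) and the window threshold `e₁` of `B4ConstantsWindow.threshold_window`.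
THE ROUTE.  The `G` pairings and b04's reading of the `δG` pairings — `⟨f, δG f′⟩, ⟨f, D_μ(δG f′)⟩, ⟨f, δG(D_ν^*f′)⟩,
⟨f, D_μ δG(D_ν^* f′)⟩` with `δG g = G_k(Ω,A)g − (G_k(Ω₀,A)Eg)|_Ω` and `D_μ, D_ν^*` those of `Ω` — are b04's kernel
theorems `B4Cor23Region.cor23_pairings_set_region` / `B4Cor23RegionDelta.dcor23_main_region` at the running `a_k`
(window bounds of `B4ConstantsWindow`).  The family's typed `dpair` reads the print's «the same inequalities hold for
δG_k(Ω,Ω₀,A)» as THE DIFFERENCE OF THE `Ω`- AND `Ω₀`-OBJECTS, `⟨f, X^Ω_m f′ − (X^{Ω₀}_m Ef′)|_Ω⟩` with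
`X_0 = G, X_1 = D_μG, X_2 = GD_ν^*, X_3 = D_μGD_ν^*` (so the derivatives of the `Ω₀`-term are those of `Ω₀`).  §3
proves that the two readings DIFFER BY `G_k(Ω₀,A)`-PAIRINGS WITH ONE SOURCE LOCALISED ON THE ONE-STEP INNER BOUNDARY
LAYER of `Ω` (the sites `x ∈ Ω` whose bond `⟨x, x+ηe⟩` leaves `Ω` inside `Ω₀`: the part `f − offL f` of a source, b04's `offL` exchange identities
`dot_regionDeriv_resV`, `dot_extV_regionDeriv_transpose`): none for `m = 0`, one for `m = 1, 2`, two for `m = 3`.  A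
boundary-localised source is within `η` of `Ω^c`, so (§4) each such pairing decays in
`½(dist(supp f,supp f′) + dist(supp f,Ω^c) + dist(supp f′,Ω^c)) − 1`, and the `G_k(Ω₀,A)` clause of (2.30) bounds it.
HONEST SCOPE.  As `B4ThmRegionPairEta` / `B4Cor23RegionEta`: abelian one-parameter flow (1.2) with a Lipschitz
generator, component fields, finite nested block unions (the big-block antecedent is carried, not used), counting `ℓ²`
norms, sup-distances in unit-lattice units, `dist(supp f, Ω^c)` = the family's `bdistS` (to ALL fine points outside
`Ω`; b04's `bdistV` to `Ω₀∖Ω` dominates it); the `δG` rate is b04's halved rate halved once more by the window; the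
constants depend on `(d, a₋, a₊, c, β, ℓ₁)`.  No `sorry`, no new `Prop` fact; axioms standard.
-/

namespace Literature.MathematicalPhysics.QuantumFieldTheory.Balaban1983to89.B4Cor23RegionPairFam

open Literature.MathematicalPhysics.QuantumFieldTheory.Balaban1983to89
open Literature.MathematicalPhysics.QuantumFieldTheory.Balaban1983to89.B4 (EtaSetting Cor23Printed)
open Literature.MathematicalPhysics.QuantumFieldTheory.Balaban1983to89.B4GaugeCovariance (OrthFlow fld fld_apply)
open Literature.MathematicalPhysics.QuantumFieldTheory.Balaban1983to89.B4ContourShift (supNorm supNorm_nonneg)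
open Literature.MathematicalPhysics.QuantumFieldTheory.Balaban1983to89.B4TorusKernel (supNorm_neg)
open Literature.MathematicalPhysics.QuantumFieldTheory.Balaban1983to89.B4Reflection242 (nbrs mem_nbrs supNorm_add_le)
open Literature.MathematicalPhysics.QuantumFieldTheory.Balaban1983to89.B4Lower18 (fineDom mem_fineDom IsBlockUnion
  edistR supNorm_sub_le_one_of_mem_nbrs)
open Literature.MathematicalPhysics.QuantumFieldTheory.Balaban1983to89.B4Lower18Regular (e1)
open Literature.MathematicalPhysics.QuantumFieldTheory.Balaban1983to89.B4Lemma21Region (regionOp regionDeriv)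
open Literature.MathematicalPhysics.QuantumFieldTheory.Balaban1983to89.B4Cor23Region (bsupp bsuppDist bl2n c0R
  delta0R c0R_pos delta0R_pos eq_zero_of_not_mem_bsupp bsuppDist_le bsuppDist_nonneg cor23_pairings_set_region
  cor23_main_region delta0R_admissible)
open Literature.MathematicalPhysics.QuantumFieldTheory.Balaban1983to89.B4Cor23ZeroDelta (outR mem_outR setDist
  inclEmb)
open Literature.MathematicalPhysics.QuantumFieldTheory.Balaban1983to89.B4Cor23RegionDeltaAlg (extV resV dGv offL
  extV_dotProduct dotProduct_extV extV_sub extV_of_not_mem offL_dot_self_le dot_regionDeriv_resV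
  dot_extV_regionDeriv_transpose dot_green_mulVec extV_dotProduct_extV)
open Literature.MathematicalPhysics.QuantumFieldTheory.Balaban1983to89.B4Cor23RegionDelta (bdistV bdistV_nonneg c1R
  two_c0R_le_c1R dcor23_main_region)
open Literature.MathematicalPhysics.QuantumFieldTheory.Balaban1983to89.B4Cor23RegionEta (labels_eq_of_outR_empty)
open Literature.MathematicalPhysics.QuantumFieldTheory.Balaban1983to89.B4ConstantsWindow (c0R_anti c1W c1R_window dW
  dW_pos dW_le threshold_window delta0R_le c0R_le_c1W)
open Literature.MathematicalPhysics.QuantumFieldTheory.Balaban1983to89.B4ThmRegionPairEta (RegionPairInst regionPairFam)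
open scoped Matrix

noncomputable section

variable {d : ℕ} {ι : Type} [Fintype ι] [DecidableEq ι]

/-! ## §1. Dictionary: the family's functionals and b04's -/

section Dictionary

variable {ℓ : ℕ} {amin aplus m2plus : ℝ} (i : RegionPairInst d ℓ amin aplus m2plus) (F : OrthFlow ι)

/-- `n = L^k ≥ 1`. [cite: Balaban1983RegularityDecay, p.572 «η = L^{−k}», dictionary] -/
private theorem one_le_n : 1 ≤ (ℓ + 1) ^ i.k := Nat.one_le_pow i.k (ℓ + 1) (Nat.succ_pos ℓ)

/-- `n > 0` as a real number. [cite: Balaban1983RegularityDecay, p.572 «η = L^{−k}», dictionary] -/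
private theorem n_pos : (0 : ℝ) < (((ℓ + 1) ^ i.k : ℕ) : ℝ) := by exact_mod_cast one_le_n i

/-- `Ω ⊆ Ω₀` at the level of fine points. [cite: Balaban1983RegularityDecay, (1.11) p.573 «Ω ⊂ Ω₀», dictionary] -/
theorem hfine : fineDom ((ℓ + 1) ^ i.k) i.Ωc ⊆ fineDom ((ℓ + 1) ^ i.k) i.Ω₀c :=
  B4Cor23RegionDeltaAlg.fineDom_mono (one_le_n i) i.hsub

omit [DecidableEq ι] in
/-- membership in the family's support. [cite: Balaban1983RegularityDecay, (1.9) p.573 «supp f», dictionary] -/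
theorem mem_supp {g : ↥(fineDom ((ℓ + 1) ^ i.k) i.Ωc) × ι → ℝ} {z : ↥(fineDom ((ℓ + 1) ^ i.k) i.Ωc)} :
    z ∈ i.supp g ↔ ∃ jj, g (z, jj) ≠ 0 := by
  classical
  unfold RegionPairInst.supp
  simp

omit [DecidableEq ι] in
/-- membership in b04's support. [cite: Balaban1983RegularityDecay, (2.30) p.580 «supp f», dictionary] -/
theorem mem_bsupp {X : Finset (Fin (d + 1) → ℤ)} {g : ↥X × ι → ℝ} {z : ↥X} :
    z ∈ bsupp g ↔ ∃ jj, g (z, jj) ≠ 0 := by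
  unfold bsupp
  simp only [Finset.mem_filter, Finset.mem_univ, true_and]
  rw [Function.ne_iff]
  rfl

omit [DecidableEq ι] in
/-- **THE TWO SUPPORTS COINCIDE**. [cite: Balaban1983RegularityDecay, (2.30) p.580 «supp f», dictionary] -/
theorem supp_eq_bsupp (g : ↥(fineDom ((ℓ + 1) ^ i.k) i.Ωc) × ι → ℝ) : i.supp g = bsupp g := by
  ext z
  rw [mem_supp, mem_bsupp]

omit [DecidableEq ι] in
/-- **THE TWO `ℓ²` NORMS COINCIDE**: `(Σ_p f(p)²)^{1/2} = ‖f‖₂`. [cite: Balaban1983RegularityDecay, (2.30) p.580 «‖f‖₂», dictionary] -/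
theorem l2_eq_bl2n {X : Type} [Fintype X] (g : X × ι → ℝ) : Real.sqrt (∑ p, g p ^ 2) = bl2n g := by
  unfold bl2n dotProduct
  congr 1
  exact Finset.sum_congr rfl fun p _ => sq (g p)

omit [DecidableEq ι] in
/-- `‖f‖₂ ≥ 0`. [cite: Balaban1983RegularityDecay, (2.30) p.580, dictionary] -/
theorem bl2n_nonneg {X : Type} [Fintype X] (g : X × ι → ℝ) : 0 ≤ bl2n g := Real.sqrt_nonneg _

omit [DecidableEq ι] in
/-- `‖u‖₂ ≤ ‖g‖₂` when `‖u‖² ≤ ‖g‖²`. [cite: Balaban1983RegularityDecay, (2.30) p.580, dictionary] -/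
theorem bl2n_le_of_dot_le {X : Type} [Fintype X] {u g : X × ι → ℝ} (h : u ⬝ᵥ u ≤ g ⬝ᵥ g) : bl2n u ≤ bl2n g :=
  Real.sqrt_le_sqrt h

omit [DecidableEq ι] in
/-- `‖Eu‖₂ = ‖u‖₂` for the extension by zero. [cite: Balaban1983RegularityDecay, (1.11) p.573, dictionary] -/
theorem bl2n_extV {X X₀ : Finset (Fin (d + 1) → ℤ)} (h : X ⊆ X₀) (u : ↥X × ι → ℝ) : bl2n (extV X₀ u) = bl2n u := by
  unfold bl2n
  rw [extV_dotProduct_extV h]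

omit [DecidableEq ι] in
/-- `dist(supp f, supp f′) ≤ |x − t|_∞/n` for `x ∈ supp f`, `t ∈ supp f′`. [cite: Balaban1983RegularityDecay, Cor. 2.3 pp.580–581 «dist(supp f, supp f′)», dictionary] -/
theorem ssdist_le (f f' : ↥(fineDom ((ℓ + 1) ^ i.k) i.Ωc) × ι → ℝ) {x t : ↥(fineDom ((ℓ + 1) ^ i.k) i.Ωc)}
    (hx : x ∈ i.supp f) (ht : t ∈ i.supp f') :
    i.ssdist f f' ≤ supNorm (x.1 - t.1) / (((ℓ + 1) ^ i.k : ℕ) : ℝ) := by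
  have hmem : (x, t) ∈ i.supp f ×ˢ i.supp f' := Finset.mem_product.2 ⟨hx, ht⟩
  have hne : (i.supp f ×ˢ i.supp f').Nonempty := ⟨(x, t), hmem⟩
  have h1 : i.ssdist f f' = (i.supp f ×ˢ i.supp f').inf' hne
      (fun p => supNorm (p.1.1 - p.2.1) / (((ℓ + 1) ^ i.k : ℕ) : ℝ)) := by
    unfold RegionPairInst.ssdist
    rw [dif_pos hne]
  rw [h1]
  exact Finset.inf'_le (s := i.supp f ×ˢ i.supp f')
    (f := fun p => supNorm (p.1.1 - p.2.1) / (((ℓ + 1) ^ i.k : ℕ) : ℝ)) hmem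

omit [DecidableEq ι] in
/-- `dist(supp f, supp f′) ≥ 0`. [cite: Balaban1983RegularityDecay, Cor. 2.3 p.581, dictionary] -/
theorem ssdist_nonneg (f f' : ↥(fineDom ((ℓ + 1) ^ i.k) i.Ωc) × ι → ℝ) : 0 ≤ i.ssdist f f' := by
  unfold RegionPairInst.ssdist
  split_ifs with h
  · exact Finset.le_inf' _ _ fun p _ => div_nonneg (supNorm_nonneg _) (Nat.cast_nonneg _)
  · exact le_rfl

omit [DecidableEq ι] in
/-- **THE FAMILY'S `dist(supp f, supp f′)` IS BELOW b04's** (they are in fact equal). [cite: Balaban1983RegularityDecay, Cor. 2.3 p.581, dictionary] -/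
theorem ssdist_le_bsuppDist (f f' : ↥(fineDom ((ℓ + 1) ^ i.k) i.Ωc) × ι → ℝ) :
    i.ssdist f f' ≤ bsuppDist ((ℓ + 1) ^ i.k) (fineDom ((ℓ + 1) ^ i.k) i.Ωc) f f' := by
  unfold bsuppDist
  split_ifs with h
  · refine Finset.le_inf' _ _ fun p hp => ?_
    obtain ⟨hx, ht⟩ := Finset.mem_product.1 hp
    rw [← supp_eq_bsupp] at hx ht
    refine (ssdist_le i f f' hx ht).trans (le_of_eq ?_)
    unfold edistR
    ring
  · have h' : ¬ (i.supp f ×ˢ i.supp f').Nonempty := by rwa [supp_eq_bsupp, supp_eq_bsupp]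
    unfold RegionPairInst.ssdist
    rw [dif_neg h']

omit [DecidableEq ι] in
/-- **THE FAMILY'S `dist(supp f, Ω^c)` IS BELOW b04's `dist_η(supp f, Ω₀∖Ω)`** (when `Ω₀∖Ω` has fine points).
[cite: Balaban1983RegularityDecay, Cor. 2.3 p.581 «dist(supp f, Ω^c)», dictionary] -/
theorem bdistS_le_bdistV (f : ↥(fineDom ((ℓ + 1) ^ i.k) i.Ωc) × ι → ℝ)
    (hout : (outR (fineDom ((ℓ + 1) ^ i.k) i.Ωc) (fineDom ((ℓ + 1) ^ i.k) i.Ω₀c)).Nonempty) :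
    i.bdistS f ≤ bdistV ((ℓ + 1) ^ i.k) (hfine i) f := by
  unfold bdistV setDist
  split_ifs with h
  · refine Finset.le_inf' _ _ fun p hp => ?_
    obtain ⟨hx, hz⟩ := Finset.mem_product.1 hp
    obtain ⟨x, hxS, hxe⟩ := Finset.mem_map.1 hx
    rw [← supp_eq_bsupp] at hxS
    refine (i.bdistS_le f hxS).trans ?_
    have h1 := i.cdist_mul_le x (mem_outR.1 hz)
    rw [← hxe]
    unfold edistR
    rw [one_div, inv_mul_eq_div, le_div_iff₀ (n_pos i)]
    exact h1
  · -- `supp f = ∅`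
    have hS : ¬ (i.supp f).Nonempty := by
      intro hS
      obtain ⟨x, hx⟩ := hS
      obtain ⟨z, hz⟩ := hout
      rw [supp_eq_bsupp] at hx
      exact h ⟨(inclEmb (hfine i) x, z), Finset.mem_product.2 ⟨Finset.mem_map_of_mem _ hx, hz⟩⟩
    unfold RegionPairInst.bdistS
    rw [dif_neg hS]

omit [Fintype ι] [DecidableEq ι] in
/-- **THE TWO EXTENSIONS BY ZERO COINCIDE**. [cite: Balaban1983RegularityDecay, (1.11) p.573, dictionary] -/
theorem extR_eq_extV (f : ↥(fineDom ((ℓ + 1) ^ i.k) i.Ωc) × ι → ℝ) :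
    i.extR f = extV (fineDom ((ℓ + 1) ^ i.k) i.Ω₀c) f := by
  funext p
  unfold RegionPairInst.extR extV B4RegionCubeCarrier.inReg
  by_cases h : p.1.1 ∈ fineDom ((ℓ + 1) ^ i.k) i.Ωc
  · have h' : B4Reflection242.blk ((ℓ + 1) ^ i.k) p.1.1 ∈ i.Ωc := (mem_fineDom (one_le_n i)).1 h
    rw [dif_pos h', dif_pos h]
  · have h' : ¬ B4Reflection242.blk ((ℓ + 1) ^ i.k) p.1.1 ∈ i.Ωc := fun hh => h ((mem_fineDom (one_le_n i)).2 hh)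
    rw [dif_neg h', dif_neg h]

omit [Fintype ι] [DecidableEq ι] in
/-- **THE TWO RESTRICTIONS COINCIDE**. [cite: Balaban1983RegularityDecay, (1.11) p.573, dictionary] -/
theorem resR_eq_resV (g : ↥(fineDom ((ℓ + 1) ^ i.k) i.Ω₀c) × ι → ℝ) : i.resR g = resV (hfine i) g := rfl

/-- `X_0 f = Gf`. [cite: Balaban1983RegularityDecay, (2.30) p.580, dictionary] -/
theorem opX_zero (μ ν : Fin (d + 1)) (f : ↥(fineDom ((ℓ + 1) ^ i.k) i.Ωc) × ι → ℝ) :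
    i.opX F 0 μ ν f = i.GΩ F *ᵥ f := by
  unfold RegionPairInst.opX; rw [if_pos rfl]

/-- `X_1 f = D_μGf`. [cite: Balaban1983RegularityDecay, (2.30) p.580, dictionary] -/
theorem opX_one (μ ν : Fin (d + 1)) (f : ↥(fineDom ((ℓ + 1) ^ i.k) i.Ωc) × ι → ℝ) :
    i.opX F 1 μ ν f = i.DΩ F μ *ᵥ (i.GΩ F *ᵥ f) := by
  unfold RegionPairInst.opX; rw [if_neg (by decide), if_pos rfl]

/-- `X_2 f = GD_ν^*f`. [cite: Balaban1983RegularityDecay, (2.30) p.580, dictionary] -/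
theorem opX_two (μ ν : Fin (d + 1)) (f : ↥(fineDom ((ℓ + 1) ^ i.k) i.Ωc) × ι → ℝ) :
    i.opX F 2 μ ν f = i.GΩ F *ᵥ ((i.DΩ F ν)ᵀ *ᵥ f) := by
  unfold RegionPairInst.opX; rw [if_neg (by decide), if_neg (by decide), if_pos rfl]; simp only [← Matrix.mulVec_mulVec]

/-- `X_3 f = D_μGD_ν^*f`. [cite: Balaban1983RegularityDecay, (2.30) p.580, dictionary] -/
theorem opX_three (μ ν : Fin (d + 1)) (f : ↥(fineDom ((ℓ + 1) ^ i.k) i.Ωc) × ι → ℝ) :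
    i.opX F 3 μ ν f = i.DΩ F μ *ᵥ (i.GΩ F *ᵥ ((i.DΩ F ν)ᵀ *ᵥ f)) := by
  unfold RegionPairInst.opX
  rw [if_neg (by decide), if_neg (by decide), if_neg (by decide)]; simp only [← Matrix.mulVec_mulVec]

/-- `X^{Ω₀}_0 g = G₀g`. [cite: Balaban1983RegularityDecay, (2.30) p.580, (1.11) p.573, dictionary] -/
theorem opX₀_zero (μ ν : Fin (d + 1)) (g : ↥(fineDom ((ℓ + 1) ^ i.k) i.Ω₀c) × ι → ℝ) :
    i.opX₀ F 0 μ ν g = i.G₀ F *ᵥ g := by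
  unfold RegionPairInst.opX₀; rw [if_pos rfl]

/-- `X^{Ω₀}_1 g = D_μG₀g`. [cite: Balaban1983RegularityDecay, (2.30) p.580, (1.11) p.573, dictionary] -/
theorem opX₀_one (μ ν : Fin (d + 1)) (g : ↥(fineDom ((ℓ + 1) ^ i.k) i.Ω₀c) × ι → ℝ) :
    i.opX₀ F 1 μ ν g = i.D₀ F μ *ᵥ (i.G₀ F *ᵥ g) := by
  unfold RegionPairInst.opX₀; rw [if_neg (by decide), if_pos rfl]

/-- `X^{Ω₀}_2 g = G₀D_ν^*g`. [cite: Balaban1983RegularityDecay, (2.30) p.580, (1.11) p.573, dictionary] -/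
theorem opX₀_two (μ ν : Fin (d + 1)) (g : ↥(fineDom ((ℓ + 1) ^ i.k) i.Ω₀c) × ι → ℝ) :
    i.opX₀ F 2 μ ν g = i.G₀ F *ᵥ ((i.D₀ F ν)ᵀ *ᵥ g) := by
  unfold RegionPairInst.opX₀; rw [if_neg (by decide), if_neg (by decide), if_pos rfl]; simp only [← Matrix.mulVec_mulVec]

/-- `X^{Ω₀}_3 g = D_μG₀D_ν^*g`. [cite: Balaban1983RegularityDecay, (2.30) p.580, (1.11) p.573, dictionary] -/
theorem opX₀_three (μ ν : Fin (d + 1)) (g : ↥(fineDom ((ℓ + 1) ^ i.k) i.Ω₀c) × ι → ℝ) :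
    i.opX₀ F 3 μ ν g = i.D₀ F μ *ᵥ (i.G₀ F *ᵥ ((i.D₀ F ν)ᵀ *ᵥ g)) := by
  unfold RegionPairInst.opX₀
  rw [if_neg (by decide), if_neg (by decide), if_neg (by decide)]; simp only [← Matrix.mulVec_mulVec]

end Dictionary

/-! ## §2. The one-step inner boundary layer: the localised part `f − offL f` of a source -/

section Layer

variable {X X₀ : Finset (Fin (d + 1) → ℤ)}

omit [Fintype ι] [DecidableEq ι] in
/-- THE PART OF A SOURCE ON THE BOUNDARY LAYER in direction `μ` is `f − offL_μ f`: it is `f` at the sites `x ∈ Ω` whose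
bond `⟨x, x + ηe_μ⟩` leaves `Ω` inside `Ω₀` (b04's `offL` zeroes exactly these), and `0` elsewhere. [cite: Balaban1983RegularityDecay, (1.3) p.572 (Neumann bonds of Ω), Cor. 2.3 p.581, dictionary] -/
theorem sub_offL_apply (μ : Fin (d + 1)) (f : ↥X × ι → ℝ) (j : ↥X × ι) :
    (f - offL X₀ μ f) j = if j.1.1 + e1 μ ∈ X₀ ∧ j.1.1 + e1 μ ∉ X then f j else 0 := by
  simp only [Pi.sub_apply, offL]
  split_ifs <;> simp

omit [Fintype ι] [DecidableEq ι] in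
/-- a site where `f − offL f` is non-zero carries `f ≠ 0` and its `μ`-bond leaves `Ω`. [cite: Balaban1983RegularityDecay, Cor. 2.3 p.581, dictionary] -/
theorem of_sub_offL_ne {μ : Fin (d + 1)} {f : ↥X × ι → ℝ} {j : ↥X × ι} (h : (f - offL X₀ μ f) j ≠ 0) :
    f j ≠ 0 ∧ j.1.1 + e1 μ ∈ X₀ ∧ j.1.1 + e1 μ ∉ X := by
  rw [sub_offL_apply] at h
  split_ifs at h with hc
  · exact ⟨h, hc⟩
  · exact absurd rfl h

omit [Fintype ι] [DecidableEq ι] in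
/-- a site where `offL f` is non-zero carries `f ≠ 0`. [cite: Balaban1983RegularityDecay, Cor. 2.3 p.581, dictionary] -/
theorem of_offL_ne {μ : Fin (d + 1)} {f : ↥X × ι → ℝ} {j : ↥X × ι} (h : offL X₀ μ f j ≠ 0) : f j ≠ 0 := by
  unfold offL at h
  split_ifs at h with hc
  · exact absurd rfl h
  · exact h

omit [DecidableEq ι] in
/-- `‖f − offL f‖² ≤ ‖f‖²`. [cite: Balaban1983RegularityDecay, Cor. 2.3 p.581, dictionary] -/
theorem sub_offL_dot_self_le (μ : Fin (d + 1)) (f : ↥X × ι → ℝ) :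
    (f - offL X₀ μ f) ⬝ᵥ (f - offL X₀ μ f) ≤ f ⬝ᵥ f := by
  unfold dotProduct
  refine Finset.sum_le_sum fun j _ => ?_
  rw [sub_offL_apply]
  split_ifs
  · exact le_rfl
  · nlinarith

end Layer

/-! ## §3. The typed `δG` pairings versus b04's: boundary-layer corrections -/

section Identities

variable {ℓ : ℕ} {amin aplus m2plus : ℝ} (i : RegionPairInst d ℓ amin aplus m2plus) (F : OrthFlow ι)

/-- the adjoint identity `⟨Φ, D₀G₀Z⟩ = ⟨G₀D₀^*Φ, Z⟩` on `Ω₀` (`G₀` symmetric). [cite: Balaban1983RegularityDecay, (1.6) p.572, (2.30) p.580, dictionary] -/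
theorem dot_D₀_G₀ (μ : Fin (d + 1)) (Φ Z : ↥(fineDom ((ℓ + 1) ^ i.k) i.Ω₀c) × ι → ℝ) :
    Φ ⬝ᵥ (i.D₀ F μ *ᵥ (i.G₀ F *ᵥ Z)) = (i.G₀ F *ᵥ ((i.D₀ F μ)ᵀ *ᵥ Φ)) ⬝ᵥ Z := by
  rw [Matrix.dotProduct_mulVec, ← Matrix.mulVec_transpose]
  exact dot_green_mulVec F i.e (one_le_n i) (B1.aSeq i.a ((ℓ : ℝ) + 1) i.k) i.m2 i.Ac i.Ω₀c _ Z

/-- **`m = 0`: THE TWO READINGS AGREE** — `⟨f, Gf′ − (G₀Ef′)|_Ω⟩ = ⟨f, δG f′⟩`. [cite: Balaban1983RegularityDecay, (1.11) p.573, Cor. 2.3 p.581] -/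
theorem dpair_zero_eq (μ ν : Fin (d + 1)) (f f' : ↥(fineDom ((ℓ + 1) ^ i.k) i.Ωc) × ι → ℝ) :
    f ⬝ᵥ (i.opX F 0 μ ν f' - i.resR (i.opX₀ F 0 μ ν (i.extR f')))
      = f ⬝ᵥ dGv (hfine i) (i.GΩ F) (i.G₀ F) f' := by
  rw [opX_zero, opX₀_zero, extR_eq_extV, resR_eq_resV]
  rfl

/-- the key exchange for `m = 1`: `⟨f, D_μ((G₀Ef′)|_Ω)⟩ = ⟨E(offL_μ f), D₀G₀Ef′⟩`. [cite: Balaban1983RegularityDecay, (1.3) p.572, (1.11) p.573, dictionary] -/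
theorem key_one (μ : Fin (d + 1)) (f f' : ↥(fineDom ((ℓ + 1) ^ i.k) i.Ωc) × ι → ℝ) :
    f ⬝ᵥ (i.DΩ F μ *ᵥ resV (hfine i) (i.G₀ F *ᵥ extV (fineDom ((ℓ + 1) ^ i.k) i.Ω₀c) f'))
      = extV (fineDom ((ℓ + 1) ^ i.k) i.Ω₀c) (offL (fineDom ((ℓ + 1) ^ i.k) i.Ω₀c) μ f)
          ⬝ᵥ (i.D₀ F μ *ᵥ (i.G₀ F *ᵥ extV (fineDom ((ℓ + 1) ^ i.k) i.Ω₀c) f')) :=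
  dot_regionDeriv_resV F i.e (one_le_n i) i.hsub i.Ac μ f _

/-- the key exchange for `m = 2`: `⟨f, (G₀E(D_ν^*f′))|_Ω⟩ = ⟨Ef, G₀D₀^*E(offL_ν f′)⟩`. [cite: Balaban1983RegularityDecay, (1.3) p.572, (1.11) p.573, dictionary] -/
theorem key_two (ν : Fin (d + 1)) (f f' : ↥(fineDom ((ℓ + 1) ^ i.k) i.Ωc) × ι → ℝ) :
    f ⬝ᵥ resV (hfine i) (i.G₀ F *ᵥ extV (fineDom ((ℓ + 1) ^ i.k) i.Ω₀c) ((i.DΩ F ν)ᵀ *ᵥ f'))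
      = extV (fineDom ((ℓ + 1) ^ i.k) i.Ω₀c) f
          ⬝ᵥ (i.G₀ F *ᵥ ((i.D₀ F ν)ᵀ *ᵥ extV (fineDom ((ℓ + 1) ^ i.k) i.Ω₀c) (offL (fineDom ((ℓ + 1) ^ i.k) i.Ω₀c) ν f'))) := by
  rw [← extV_dotProduct (hfine i),
    dot_green_mulVec F i.e (one_le_n i) (B1.aSeq i.a ((ℓ : ℝ) + 1) i.k) i.m2 i.Ac i.Ω₀c,
    dot_extV_regionDeriv_transpose F i.e (one_le_n i) i.hsub i.Ac ν _ f',
    ← dot_green_mulVec F i.e (one_le_n i) (B1.aSeq i.a ((ℓ : ℝ) + 1) i.k) i.m2 i.Ac i.Ω₀c]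

/-- the key exchange for `m = 3`: `⟨f, D_μ((G₀E(D_ν^*f′))|_Ω)⟩ = ⟨E(offL_μ f), D₀G₀D₀^*E(offL_ν f′)⟩`. [cite: Balaban1983RegularityDecay, (1.3) p.572, (1.11) p.573, dictionary] -/
theorem key_three (μ ν : Fin (d + 1)) (f f' : ↥(fineDom ((ℓ + 1) ^ i.k) i.Ωc) × ι → ℝ) :
    f ⬝ᵥ (i.DΩ F μ *ᵥ resV (hfine i) (i.G₀ F *ᵥ extV (fineDom ((ℓ + 1) ^ i.k) i.Ω₀c) ((i.DΩ F ν)ᵀ *ᵥ f')))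
      = extV (fineDom ((ℓ + 1) ^ i.k) i.Ω₀c) (offL (fineDom ((ℓ + 1) ^ i.k) i.Ω₀c) μ f)
          ⬝ᵥ (i.D₀ F μ *ᵥ (i.G₀ F *ᵥ ((i.D₀ F ν)ᵀ *ᵥ
              extV (fineDom ((ℓ + 1) ^ i.k) i.Ω₀c) (offL (fineDom ((ℓ + 1) ^ i.k) i.Ω₀c) ν f')))) := by
  rw [dot_regionDeriv_resV F i.e (one_le_n i) i.hsub i.Ac μ f _, dot_D₀_G₀,
    dot_extV_regionDeriv_transpose F i.e (one_le_n i) i.hsub i.Ac ν _ f', ← dot_D₀_G₀]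

omit [Fintype ι] [DecidableEq ι] in
/-- the extension of a source splits along the `μ`-layer: `Ef = E(f − offL_μ f) + E(offL_μ f)`. [cite: Balaban1983RegularityDecay, (1.11) p.573, dictionary] -/
theorem extV_split (μ : Fin (d + 1)) (g : ↥(fineDom ((ℓ + 1) ^ i.k) i.Ωc) × ι → ℝ) :
    extV (fineDom ((ℓ + 1) ^ i.k) i.Ω₀c) g
      = extV (fineDom ((ℓ + 1) ^ i.k) i.Ω₀c) (g - offL (fineDom ((ℓ + 1) ^ i.k) i.Ω₀c) μ g)
        + extV (fineDom ((ℓ + 1) ^ i.k) i.Ω₀c) (offL (fineDom ((ℓ + 1) ^ i.k) i.Ω₀c) μ g) := by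
  rw [← B4Cor23RegionDeltaAlg.extV_add, sub_add_cancel]

/-- **`m = 1`: ONE CORRECTION** — `⟨f, D_μGf′ − (D₀G₀Ef′)|_Ω⟩ = ⟨f, D_μ δG f′⟩ − ⟨E(f − offL_μ f), D₀G₀Ef′⟩`. [cite: Balaban1983RegularityDecay, (1.3) p.572, (1.11) p.573, Cor. 2.3 p.581] -/
theorem dpair_one_eq (μ ν : Fin (d + 1)) (f f' : ↥(fineDom ((ℓ + 1) ^ i.k) i.Ωc) × ι → ℝ) :
    f ⬝ᵥ (i.opX F 1 μ ν f' - i.resR (i.opX₀ F 1 μ ν (i.extR f')))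
      = f ⬝ᵥ (i.DΩ F μ *ᵥ dGv (hfine i) (i.GΩ F) (i.G₀ F) f')
        - extV (fineDom ((ℓ + 1) ^ i.k) i.Ω₀c) ((f - offL (fineDom ((ℓ + 1) ^ i.k) i.Ω₀c) μ f))
          ⬝ᵥ (i.D₀ F μ *ᵥ (i.G₀ F *ᵥ extV (fineDom ((ℓ + 1) ^ i.k) i.Ω₀c) f')) := by
  have h1 : f ⬝ᵥ i.resR (i.opX₀ F 1 μ ν (i.extR f'))
      = extV (fineDom ((ℓ + 1) ^ i.k) i.Ω₀c) f ⬝ᵥ (i.D₀ F μ *ᵥ (i.G₀ F *ᵥ extV (fineDom ((ℓ + 1) ^ i.k) i.Ω₀c) f')) := by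
    rw [opX₀_one, extR_eq_extV, resR_eq_resV, ← extV_dotProduct (hfine i)]
  have h2 : f ⬝ᵥ (i.DΩ F μ *ᵥ dGv (hfine i) (i.GΩ F) (i.G₀ F) f')
      = f ⬝ᵥ (i.DΩ F μ *ᵥ (i.GΩ F *ᵥ f'))
        - extV (fineDom ((ℓ + 1) ^ i.k) i.Ω₀c) (offL (fineDom ((ℓ + 1) ^ i.k) i.Ω₀c) μ f)
          ⬝ᵥ (i.D₀ F μ *ᵥ (i.G₀ F *ᵥ extV (fineDom ((ℓ + 1) ^ i.k) i.Ω₀c) f')) := by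
    unfold dGv
    rw [Matrix.mulVec_sub, dotProduct_sub, key_one]
  rw [dotProduct_sub, opX_one, h1, h2, extV_split i μ f, add_dotProduct]
  ring

/-- **`m = 2`: ONE CORRECTION** — `⟨f, GD_ν^*f′ − (G₀D₀^*Ef′)|_Ω⟩ = ⟨f, δG(D_ν^*f′)⟩ − ⟨Ef, G₀D₀^*E(f′ − offL_ν f′)⟩`. [cite: Balaban1983RegularityDecay, (1.3) p.572, (1.11) p.573, Cor. 2.3 p.581] -/
theorem dpair_two_eq (μ ν : Fin (d + 1)) (f f' : ↥(fineDom ((ℓ + 1) ^ i.k) i.Ωc) × ι → ℝ) :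
    f ⬝ᵥ (i.opX F 2 μ ν f' - i.resR (i.opX₀ F 2 μ ν (i.extR f')))
      = f ⬝ᵥ dGv (hfine i) (i.GΩ F) (i.G₀ F) ((i.DΩ F ν)ᵀ *ᵥ f')
        - extV (fineDom ((ℓ + 1) ^ i.k) i.Ω₀c) f
          ⬝ᵥ (i.G₀ F *ᵥ ((i.D₀ F ν)ᵀ *ᵥ extV (fineDom ((ℓ + 1) ^ i.k) i.Ω₀c) ((f' - offL (fineDom ((ℓ + 1) ^ i.k) i.Ω₀c) ν f')))) := by
  have h1 : f ⬝ᵥ i.resR (i.opX₀ F 2 μ ν (i.extR f'))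
      = extV (fineDom ((ℓ + 1) ^ i.k) i.Ω₀c) f
          ⬝ᵥ (i.G₀ F *ᵥ ((i.D₀ F ν)ᵀ *ᵥ extV (fineDom ((ℓ + 1) ^ i.k) i.Ω₀c) f')) := by
    rw [opX₀_two, extR_eq_extV, resR_eq_resV, ← extV_dotProduct (hfine i)]
  have h2 : f ⬝ᵥ dGv (hfine i) (i.GΩ F) (i.G₀ F) ((i.DΩ F ν)ᵀ *ᵥ f')
      = f ⬝ᵥ (i.GΩ F *ᵥ ((i.DΩ F ν)ᵀ *ᵥ f'))
        - extV (fineDom ((ℓ + 1) ^ i.k) i.Ω₀c) f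
          ⬝ᵥ (i.G₀ F *ᵥ ((i.D₀ F ν)ᵀ *ᵥ extV (fineDom ((ℓ + 1) ^ i.k) i.Ω₀c) (offL (fineDom ((ℓ + 1) ^ i.k) i.Ω₀c) ν f'))) := by
    unfold dGv
    rw [dotProduct_sub, key_two]
  rw [dotProduct_sub, opX_two, h1, h2, extV_split i ν f', Matrix.mulVec_add, Matrix.mulVec_add, dotProduct_add]
  ring

/-- **`m = 3`: TWO CORRECTIONS** — `⟨f, D_μGD_ν^*f′ − (D₀G₀D₀^*Ef′)|_Ω⟩ = ⟨f, D_μ δG(D_ν^*f′)⟩ − ⟨E(f − offL_μ f), D₀G₀D₀^*Ef′⟩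
− ⟨E(offL_μ f), D₀G₀D₀^*E(f′ − offL_ν f′)⟩`. [cite: Balaban1983RegularityDecay, (1.3) p.572, (1.11) p.573, Cor. 2.3 p.581] -/
theorem dpair_three_eq (μ ν : Fin (d + 1)) (f f' : ↥(fineDom ((ℓ + 1) ^ i.k) i.Ωc) × ι → ℝ) :
    f ⬝ᵥ (i.opX F 3 μ ν f' - i.resR (i.opX₀ F 3 μ ν (i.extR f')))
      = f ⬝ᵥ (i.DΩ F μ *ᵥ dGv (hfine i) (i.GΩ F) (i.G₀ F) ((i.DΩ F ν)ᵀ *ᵥ f'))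
        - extV (fineDom ((ℓ + 1) ^ i.k) i.Ω₀c) ((f - offL (fineDom ((ℓ + 1) ^ i.k) i.Ω₀c) μ f))
          ⬝ᵥ (i.D₀ F μ *ᵥ (i.G₀ F *ᵥ ((i.D₀ F ν)ᵀ *ᵥ extV (fineDom ((ℓ + 1) ^ i.k) i.Ω₀c) f')))
        - extV (fineDom ((ℓ + 1) ^ i.k) i.Ω₀c) (offL (fineDom ((ℓ + 1) ^ i.k) i.Ω₀c) μ f)
          ⬝ᵥ (i.D₀ F μ *ᵥ (i.G₀ F *ᵥ ((i.D₀ F ν)ᵀ *ᵥ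
              extV (fineDom ((ℓ + 1) ^ i.k) i.Ω₀c) ((f' - offL (fineDom ((ℓ + 1) ^ i.k) i.Ω₀c) ν f'))))) := by
  have h1 : f ⬝ᵥ i.resR (i.opX₀ F 3 μ ν (i.extR f'))
      = extV (fineDom ((ℓ + 1) ^ i.k) i.Ω₀c) f
          ⬝ᵥ (i.D₀ F μ *ᵥ (i.G₀ F *ᵥ ((i.D₀ F ν)ᵀ *ᵥ extV (fineDom ((ℓ + 1) ^ i.k) i.Ω₀c) f'))) := by
    rw [opX₀_three, extR_eq_extV, resR_eq_resV, ← extV_dotProduct (hfine i)]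
  have h2 : f ⬝ᵥ (i.DΩ F μ *ᵥ dGv (hfine i) (i.GΩ F) (i.G₀ F) ((i.DΩ F ν)ᵀ *ᵥ f'))
      = f ⬝ᵥ (i.DΩ F μ *ᵥ (i.GΩ F *ᵥ ((i.DΩ F ν)ᵀ *ᵥ f')))
        - extV (fineDom ((ℓ + 1) ^ i.k) i.Ω₀c) (offL (fineDom ((ℓ + 1) ^ i.k) i.Ω₀c) μ f)
          ⬝ᵥ (i.D₀ F μ *ᵥ (i.G₀ F *ᵥ ((i.D₀ F ν)ᵀ *ᵥ
              extV (fineDom ((ℓ + 1) ^ i.k) i.Ω₀c) (offL (fineDom ((ℓ + 1) ^ i.k) i.Ω₀c) ν f')))) := by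
    unfold dGv
    rw [Matrix.mulVec_sub, dotProduct_sub, key_three]
  rw [dotProduct_sub, opX_three, h1, h2, extV_split i μ f, extV_split i ν f']
  simp only [add_dotProduct, Matrix.mulVec_add, dotProduct_add]
  ring

end Identities

/-! ## §4. Distances from a boundary-localised source; the correction pairings decay -/

section Corrections

variable {ℓ : ℕ} {amin aplus m2plus : ℝ} (i : RegionPairInst d ℓ amin aplus m2plus) (F : OrthFlow ι)

omit [Fintype ι] [DecidableEq ι] in
/-- `|t − (x + e_μ)|_∞ ≤ |x − t|_∞ + 1`. [folklore] -/
private theorem supNorm_sub_add_e1_le (x t : Fin (d + 1) → ℤ) (μ : Fin (d + 1)) :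
    supNorm (t - (x + e1 μ)) ≤ supNorm (x - t) + 1 := by
  have h1 : t - (x + e1 μ) = (t - x) + (x - (x + e1 μ)) := by abel
  have h2 : supNorm (x - (x + e1 μ)) ≤ 1 :=
    supNorm_sub_le_one_of_mem_nbrs ((mem_nbrs).2 ⟨μ, Or.inl rfl⟩)
  have h3 : supNorm (t - x) = supNorm (x - t) := by rw [← supNorm_neg, neg_sub]
  rw [h1]
  exact (supNorm_add_le _ _).trans (by rw [h3]; linarith)

omit [DecidableEq ι] in
/-- **THE DECAY LENGTH OF A CORRECTION**: for `x ∈ supp f`, `t ∈ supp f′` with the `μ`-bond of `x` or the `ν`-bond of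
`t` leaving `Ω`,  `½(dist(supp f, supp f′) + dist(supp f, Ω^c) + dist(supp f′, Ω^c)) − 1 ≤ |x − t|_∞/n`.
[cite: Balaban1983RegularityDecay, Cor. 2.3 p.581 «e^{−δ₀(dist(supp f,Ω^c) + dist(supp f′,Ω^c))}», dictionary] -/
theorem rho_le (f f' : ↥(fineDom ((ℓ + 1) ^ i.k) i.Ωc) × ι → ℝ) {x t : ↥(fineDom ((ℓ + 1) ^ i.k) i.Ωc)}
    (hx : x ∈ i.supp f) (ht : t ∈ i.supp f') {μ ν : Fin (d + 1)}
    (hloc : x.1 + e1 μ ∉ fineDom ((ℓ + 1) ^ i.k) i.Ωc ∨ t.1 + e1 ν ∉ fineDom ((ℓ + 1) ^ i.k) i.Ωc) :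
    (i.ssdist f f' + i.bdistS f + i.bdistS f') / 2 - 1 ≤ supNorm (x.1 - t.1) / (((ℓ + 1) ^ i.k : ℕ) : ℝ) := by
  have hnr := n_pos i
  have hn1 : (1 : ℝ) ≤ (((ℓ + 1) ^ i.k : ℕ) : ℝ) := by exact_mod_cast one_le_n i
  have hs := ssdist_le i f f' hx ht
  have hD0 : 0 ≤ supNorm (x.1 - t.1) := supNorm_nonneg _
  -- `n · b ≤ |x − t| + 1` gives `b ≤ |x − t|/n + 1`
  have hconv : ∀ {b : ℝ}, b * (((ℓ + 1) ^ i.k : ℕ) : ℝ) ≤ supNorm (x.1 - t.1) + 1 →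
      b ≤ supNorm (x.1 - t.1) / (((ℓ + 1) ^ i.k : ℕ) : ℝ) + 1 := by
    intro b hb
    rw [div_add_one (ne_of_gt hnr), le_div_iff₀ hnr]
    nlinarith
  have hconv1 : ∀ {b : ℝ}, b * (((ℓ + 1) ^ i.k : ℕ) : ℝ) ≤ 1 → b ≤ 1 := by
    intro b hb
    rcases le_or_gt b 0 with hb0 | hb0
    · linarith
    · nlinarith
  rcases hloc with hxμ | htν
  · have hb : i.bdistS f ≤ 1 := by
      refine hconv1 ((mul_le_mul_of_nonneg_right (i.bdistS_le f hx) hnr.le).trans ?_)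
      exact (i.cdist_mul_le x hxμ).trans (supNorm_sub_le_one_of_mem_nbrs ((mem_nbrs).2 ⟨μ, Or.inl rfl⟩))
    have hb' : i.bdistS f' ≤ supNorm (x.1 - t.1) / (((ℓ + 1) ^ i.k : ℕ) : ℝ) + 1 := by
      refine hconv ((mul_le_mul_of_nonneg_right (i.bdistS_le f' ht) hnr.le).trans ?_)
      exact (i.cdist_mul_le t hxμ).trans (supNorm_sub_add_e1_le x.1 t.1 μ)
    linarith
  · have hb' : i.bdistS f' ≤ 1 := by
      refine hconv1 ((mul_le_mul_of_nonneg_right (i.bdistS_le f' ht) hnr.le).trans ?_)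
      exact (i.cdist_mul_le t htν).trans (supNorm_sub_le_one_of_mem_nbrs ((mem_nbrs).2 ⟨ν, Or.inl rfl⟩))
    have hb : i.bdistS f ≤ supNorm (x.1 - t.1) / (((ℓ + 1) ^ i.k : ℕ) : ℝ) + 1 := by
      refine hconv ((mul_le_mul_of_nonneg_right (i.bdistS_le f hx) hnr.le).trans ?_)
      have h3 : supNorm (t.1 - x.1) = supNorm (x.1 - t.1) := by rw [← supNorm_neg, neg_sub]
      exact (i.cdist_mul_le x htν).trans ((supNorm_sub_add_e1_le t.1 x.1 ν).trans (by rw [h3]))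
    linarith

omit [DecidableEq ι] in
/-- the extension of `u` vanishes off the carried support of `u`. [cite: Balaban1983RegularityDecay, (1.11) p.573, dictionary] -/
theorem extV_eq_zero_of_not_mem_suppE (u : ↥(fineDom ((ℓ + 1) ^ i.k) i.Ωc) × ι → ℝ)
    (j : ↥(fineDom ((ℓ + 1) ^ i.k) i.Ω₀c) × ι) (hj : j.1 ∉ (i.supp u).map (inclEmb (hfine i))) :
    extV (fineDom ((ℓ + 1) ^ i.k) i.Ω₀c) u j = 0 := by
  by_cases hm : j.1.1 ∈ fineDom ((ℓ + 1) ^ i.k) i.Ωc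
  · have hnot : (⟨j.1.1, hm⟩ : ↥(fineDom ((ℓ + 1) ^ i.k) i.Ωc)) ∉ i.supp u := by
      intro h
      refine hj (Finset.mem_map.2 ⟨⟨j.1.1, hm⟩, h, ?_⟩)
      exact Subtype.ext rfl
    have h0 := i.eq_zero_of_not_mem_supp u (⟨j.1.1, hm⟩, j.2) hnot
    unfold extV
    rw [dif_pos hm]
    exact h0
  · exact extV_of_not_mem u j hm

omit [DecidableEq ι] in
/-- members of the carried support come from `supp u`. [cite: Balaban1983RegularityDecay, (1.11) p.573, dictionary] -/
theorem exists_of_mem_suppE {u : ↥(fineDom ((ℓ + 1) ^ i.k) i.Ωc) × ι → ℝ} {y : ↥(fineDom ((ℓ + 1) ^ i.k) i.Ω₀c)}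
    (hy : y ∈ (i.supp u).map (inclEmb (hfine i))) : ∃ x : ↥(fineDom ((ℓ + 1) ^ i.k) i.Ωc), x ∈ i.supp u ∧ y = inclEmb (hfine i) x := by
  obtain ⟨x, hx, hxe⟩ := Finset.mem_map.1 hy
  exact ⟨x, hx, hxe.symm⟩

omit [Fintype ι] [DecidableEq ι] in
/-- the distance of carried sites is the distance of the sites. [cite: Balaban1983RegularityDecay, (1.11) p.573, dictionary] -/
theorem edistR_inclEmb (x t : ↥(fineDom ((ℓ + 1) ^ i.k) i.Ωc)) :
    edistR ((ℓ + 1) ^ i.k) (fineDom ((ℓ + 1) ^ i.k) i.Ω₀c) (inclEmb (hfine i) x) (inclEmb (hfine i) t)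
      = supNorm (x.1 - t.1) / (((ℓ + 1) ^ i.k : ℕ) : ℝ) := by
  unfold edistR
  rw [one_div, ← div_eq_inv_mul]
  rfl

variable {ℓ₁ : ℝ} (hℓ₁ : 0 ≤ ℓ₁)
  (hLip : ∀ t (v : ι → ℝ), ((F.U t - 1) *ᵥ v) ⬝ᵥ ((F.U t - 1) *ᵥ v) ≤ (ℓ₁ * t) ^ 2 * (v ⬝ᵥ v))
  (he : 0 < i.e) (ha : 0 < B1.aSeq i.a ((ℓ : ℝ) + 1) i.k) {creg β : ℝ} (hcreg : 0 ≤ creg)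
  (h17 : ∀ x ∈ fineDom ((ℓ + 1) ^ i.k) i.Ω₀c, ∀ μ ν : Fin (d + 1),
    |i.Ac (x + e1 μ) ν - i.Ac x ν| ≤ creg * i.e ^ (β - 1) / ((ℓ + 1) ^ i.k : ℕ))
  (hsmall : ℓ₁ ^ 2 * ((d + 1) * creg * i.e ^ β) ^ 2 * (d + 1) * (1 + B1.aSeq i.a ((ℓ : ℝ) + 1) i.k * (d + 1))
    ≤ min 2 (B1.aSeq i.a ((ℓ : ℝ) + 1) i.k) / 4)

include hℓ₁ hLip he ha hcreg h17 hsmall in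
/-- **A CORRECTION PAIRING DECAYS** (the `G_k(Ω₀,A)` clause of (2.30) on `Ω₀`, b04's set form): for sources `u`, `v`
on `Ω` with `supp u ⊆ supp f`, `supp v ⊆ supp f′`, and `u` localised on the `μ′`-layer or `v` on the `ν′`-layer, each
of the four pairings `⟨Eu, X^{Ω₀}_m Ev⟩` is at most `c0R(a_k)·e^{−δ(½(dist(supp f,supp f′) + dist(supp f,Ω^c) +
dist(supp f′,Ω^c)) − 1)}‖Eu‖₂‖Ev‖₂`, `δ = delta0R d a_k`. [cite: Balaban1983RegularityDecay, Cor. 2.3 (2.30) p.580 + δG clause p.581] -/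
theorem corr_bound (μ ν μ' ν' : Fin (d + 1)) (f f' u v : ↥(fineDom ((ℓ + 1) ^ i.k) i.Ωc) × ι → ℝ)
    (hu : ∀ p, u p ≠ 0 → f p ≠ 0) (hv : ∀ p, v p ≠ 0 → f' p ≠ 0)
    (hloc : (∀ p, u p ≠ 0 → p.1.1 + e1 μ' ∉ fineDom ((ℓ + 1) ^ i.k) i.Ωc) ∨
      (∀ p, v p ≠ 0 → p.1.1 + e1 ν' ∉ fineDom ((ℓ + 1) ^ i.k) i.Ωc)) :
    |extV (fineDom ((ℓ + 1) ^ i.k) i.Ω₀c) u ⬝ᵥ (i.G₀ F *ᵥ extV (fineDom ((ℓ + 1) ^ i.k) i.Ω₀c) v)|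
        ≤ c0R (B1.aSeq i.a ((ℓ : ℝ) + 1) i.k)
          * Real.exp (-(delta0R d (B1.aSeq i.a ((ℓ : ℝ) + 1) i.k) * ((i.ssdist f f' + i.bdistS f + i.bdistS f') / 2 - 1)))
          * bl2n (extV (fineDom ((ℓ + 1) ^ i.k) i.Ω₀c) u) * bl2n (extV (fineDom ((ℓ + 1) ^ i.k) i.Ω₀c) v) ∧
    |extV (fineDom ((ℓ + 1) ^ i.k) i.Ω₀c) u ⬝ᵥ (i.D₀ F μ *ᵥ (i.G₀ F *ᵥ extV (fineDom ((ℓ + 1) ^ i.k) i.Ω₀c) v))|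
        ≤ c0R (B1.aSeq i.a ((ℓ : ℝ) + 1) i.k)
          * Real.exp (-(delta0R d (B1.aSeq i.a ((ℓ : ℝ) + 1) i.k) * ((i.ssdist f f' + i.bdistS f + i.bdistS f') / 2 - 1)))
          * bl2n (extV (fineDom ((ℓ + 1) ^ i.k) i.Ω₀c) u) * bl2n (extV (fineDom ((ℓ + 1) ^ i.k) i.Ω₀c) v) ∧
    |extV (fineDom ((ℓ + 1) ^ i.k) i.Ω₀c) u
        ⬝ᵥ (i.G₀ F *ᵥ ((i.D₀ F ν)ᵀ *ᵥ extV (fineDom ((ℓ + 1) ^ i.k) i.Ω₀c) v))|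
        ≤ c0R (B1.aSeq i.a ((ℓ : ℝ) + 1) i.k)
          * Real.exp (-(delta0R d (B1.aSeq i.a ((ℓ : ℝ) + 1) i.k) * ((i.ssdist f f' + i.bdistS f + i.bdistS f') / 2 - 1)))
          * bl2n (extV (fineDom ((ℓ + 1) ^ i.k) i.Ω₀c) u) * bl2n (extV (fineDom ((ℓ + 1) ^ i.k) i.Ω₀c) v) ∧
    |extV (fineDom ((ℓ + 1) ^ i.k) i.Ω₀c) u
        ⬝ᵥ (i.D₀ F μ *ᵥ (i.G₀ F *ᵥ ((i.D₀ F ν)ᵀ *ᵥ extV (fineDom ((ℓ + 1) ^ i.k) i.Ω₀c) v)))|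
        ≤ c0R (B1.aSeq i.a ((ℓ : ℝ) + 1) i.k)
          * Real.exp (-(delta0R d (B1.aSeq i.a ((ℓ : ℝ) + 1) i.k) * ((i.ssdist f f' + i.bdistS f + i.bdistS f') / 2 - 1)))
          * bl2n (extV (fineDom ((ℓ + 1) ^ i.k) i.Ω₀c) u) * bl2n (extV (fineDom ((ℓ + 1) ^ i.k) i.Ω₀c) v) := by
  obtain ⟨hδ0, hδ1, hct⟩ := delta0R_admissible d ha
  -- the distance between the carried supports
  have hρ : ∀ y ∈ (i.supp u).map (inclEmb (hfine i)), ∀ s ∈ (i.supp v).map (inclEmb (hfine i)),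
      (i.ssdist f f' + i.bdistS f + i.bdistS f') / 2 - 1
        ≤ edistR ((ℓ + 1) ^ i.k) (fineDom ((ℓ + 1) ^ i.k) i.Ω₀c) y s := by
    intro y hy s hs
    obtain ⟨x, hx, rfl⟩ := exists_of_mem_suppE i hy
    obtain ⟨t, ht, rfl⟩ := exists_of_mem_suppE i hs
    obtain ⟨jx, hjx⟩ := (mem_supp i).1 hx
    obtain ⟨jt, hjt⟩ := (mem_supp i).1 ht
    have hxf : x ∈ i.supp f := (mem_supp i).2 ⟨jx, hu _ hjx⟩
    have htf : t ∈ i.supp f' := (mem_supp i).2 ⟨jt, hv _ hjt⟩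
    have hloc' : x.1 + e1 μ' ∉ fineDom ((ℓ + 1) ^ i.k) i.Ωc ∨ t.1 + e1 ν' ∉ fineDom ((ℓ + 1) ^ i.k) i.Ωc :=
      hloc.imp (fun h => h _ hjx) (fun h => h _ hjt)
    rw [edistR_inclEmb]
    exact rho_le i f f' hxf htf hloc'
  exact cor23_pairings_set_region F hℓ₁ hLip he (one_le_n i) ha i.hm1 i.Ω₀c hcreg h17 hsmall hδ0 hδ1 hct
    ((i.supp u).map (inclEmb (hfine i))) ((i.supp v).map (inclEmb (hfine i))) _ hρ (extV _ u) (extV _ v)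
    (fun j hj => extV_eq_zero_of_not_mem_suppE i u j hj) (fun j hj => extV_eq_zero_of_not_mem_suppE i v j hj) μ ν

end Corrections

/-! ## §5. Corollary 2.3 on the family of general region pairs -/

section Main

omit [Fintype ι] [DecidableEq ι] in
/-- weakening of a (2.30)-shape bound. [cite: Balaban1983RegularityDecay, Cor. 2.3 (2.30) p.580, constants] -/
theorem weak4 {p c c' δ δ' D D' nf ng : ℝ} (hp : p ≤ c * Real.exp (-(δ * D)) * nf * ng) (hc0 : 0 ≤ c)
    (hc : c ≤ c') (hδ0 : 0 ≤ δ') (hδ : δ' ≤ δ) (hD0 : 0 ≤ D') (hD : D' ≤ D) (hf : 0 ≤ nf) (hg : 0 ≤ ng) :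
    p ≤ c' * Real.exp (-(δ' * D')) * nf * ng := by
  have h1 : δ' * D' ≤ δ * D := mul_le_mul hδ hD hD0 (hδ0.trans hδ)
  refine hp.trans (mul_le_mul_of_nonneg_right (mul_le_mul_of_nonneg_right ?_ hf) hg)
  exact mul_le_mul hc (Real.exp_le_exp.2 (by linarith)) (Real.exp_pos _).le (hc0.trans hc)

omit [Fintype ι] [DecidableEq ι] in
/-- weakening of a `δG`-clause-shape bound with a joint exponent into the typed shape. [cite: Balaban1983RegularityDecay, Cor. 2.3 p.581 (δG clause), constants] -/
theorem weak5 {p c c' δ δ' D D' B B₁ B' B₁' nf nf' ng ng' : ℝ}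
    (hp : p ≤ c * Real.exp (-(δ * (D + B + B'))) * nf * ng)
    (hc0 : 0 ≤ c) (hc : c ≤ c') (hδ0 : 0 ≤ δ') (hδ : δ' ≤ δ) (hD0 : 0 ≤ D') (hD : D' ≤ D) (hB0 : 0 ≤ B₁)
    (hB : B₁ ≤ B) (hB0' : 0 ≤ B₁') (hB' : B₁' ≤ B') (hf0 : 0 ≤ nf) (hf : nf ≤ nf') (hg0 : 0 ≤ ng)
    (hg : ng ≤ ng') :
    p ≤ c' * Real.exp (-(δ' * D')) * Real.exp (-(δ' * (B₁ + B₁'))) * nf' * ng' := by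
  have hδ₀ : 0 ≤ δ := hδ0.trans hδ
  have h1 : δ' * D' ≤ δ * D := mul_le_mul hδ hD hD0 hδ₀
  have h2 : δ' * B₁ ≤ δ * B := mul_le_mul hδ hB hB0 hδ₀
  have h3 : δ' * B₁' ≤ δ * B' := mul_le_mul hδ hB' hB0' hδ₀
  have hexp : Real.exp (-(δ * (D + B + B'))) ≤ Real.exp (-(δ' * D')) * Real.exp (-(δ' * (B₁ + B₁'))) := by
    rw [← Real.exp_add]; exact Real.exp_le_exp.2 (by nlinarith)
  have hc'0 : 0 ≤ c' := hc0.trans hc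
  have hA : c * Real.exp (-(δ * (D + B + B')))
      ≤ c' * (Real.exp (-(δ' * D')) * Real.exp (-(δ' * (B₁ + B₁')))) :=
    mul_le_mul hc hexp (Real.exp_pos _).le hc'0
  have hA0 : 0 ≤ c' * (Real.exp (-(δ' * D')) * Real.exp (-(δ' * (B₁ + B₁')))) := by positivity
  calc p ≤ c * Real.exp (-(δ * (D + B + B'))) * nf * ng := hp
    _ ≤ c' * (Real.exp (-(δ' * D')) * Real.exp (-(δ' * (B₁ + B₁')))) * nf' * ng' :=
        mul_le_mul (mul_le_mul hA hf hf0 hA0) hg hg0 (mul_nonneg hA0 (hf0.trans hf))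
    _ = _ := by ring

variable {ℓ : ℕ} {amin aplus m2plus : ℝ}

/-- the degenerate instance `Ω₀ = Ω`: restriction after extension is the identity on the same carrier, so every typed
`δG` pairing vanishes. [cite: Balaban1983RegularityDecay, (1.11) p.573 «δG_k(Ω,Ω₀,A) = G_k(Ω,A) − G_k(Ω₀,A)», dictionary] -/
theorem dpair_eq_zero_of_eq (i : RegionPairInst d ℓ amin aplus m2plus) (F : OrthFlow ι) (hEq : i.Ω₀c = i.Ωc)
    (m : Fin 4) (μ ν : Fin (d + 1)) (f f' : ↥(fineDom ((ℓ + 1) ^ i.k) i.Ωc) × ι → ℝ) :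
    f ⬝ᵥ (i.opX F m μ ν f' - i.resR (i.opX₀ F m μ ν (i.extR f'))) = 0 := by
  obtain ⟨k, hk, Ω₀c, Ωc, hsub, a, m2, ha1, ha2, hm1, hm2, Ac, e⟩ := i
  dsimp only at hEq f f' ⊢
  cases hEq
  have hext : RegionPairInst.extR (⟨k, hk, Ω₀c, Ω₀c, hsub, a, m2, ha1, ha2, hm1, hm2, Ac, e⟩ :
      RegionPairInst d ℓ amin aplus m2plus) f' = f' := by
    funext p
    unfold RegionPairInst.extR
    dsimp only
    rw [dif_pos (show B4RegionCubeCarrier.inReg ((ℓ + 1) ^ k) Ω₀c p.1 from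
      (mem_fineDom (Nat.one_le_pow k (ℓ + 1) (Nat.succ_pos ℓ))).1 p.1.2)]
  have hres : ∀ g : ↥(fineDom ((ℓ + 1) ^ k) Ω₀c) × ι → ℝ,
      RegionPairInst.resR (⟨k, hk, Ω₀c, Ω₀c, hsub, a, m2, ha1, ha2, hm1, hm2, Ac, e⟩ :
        RegionPairInst d ℓ amin aplus m2plus) g = g := fun g => rfl
  have hX : ∀ g : ↥(fineDom ((ℓ + 1) ^ k) Ω₀c) × ι → ℝ,
      RegionPairInst.opX₀ (⟨k, hk, Ω₀c, Ω₀c, hsub, a, m2, ha1, ha2, hm1, hm2, Ac, e⟩ :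
        RegionPairInst d ℓ amin aplus m2plus) F m μ ν g
        = RegionPairInst.opX (⟨k, hk, Ω₀c, Ω₀c, hsub, a, m2, ha1, ha2, hm1, hm2, Ac, e⟩ :
          RegionPairInst d ℓ amin aplus m2plus) F m μ ν g := fun g => rfl
  rw [hext, hres, hX, sub_self, dotProduct_zero]

omit [Fintype ι] [DecidableEq ι] in
/-- `e^{1/8} ≤ 3`. [folklore] -/
private theorem exp_eighth_le_three : Real.exp (1 / 8 : ℝ) ≤ 3 := by
  have h1 : Real.exp (1 / 8 : ℝ) ≤ Real.exp 1 := Real.exp_le_exp.2 (by norm_num)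
  have h2 := Real.exp_one_lt_d9
  linarith [h2]

omit [Fintype ι] [DecidableEq ι] in
/-- monotonicity of a joint-exponent bound in its three distances. [cite: Balaban1983RegularityDecay, Cor. 2.3 p.581 (δG clause), constants] -/
theorem weak3 {p c δ D D' B B₁ B' B₁' nf ng : ℝ} (hp : p ≤ c * Real.exp (-(δ * (D + B + B'))) * nf * ng)
    (hc0 : 0 ≤ c) (hδ0 : 0 ≤ δ) (hD : D' ≤ D) (hB : B₁ ≤ B) (hB' : B₁' ≤ B') (hf0 : 0 ≤ nf) (hg0 : 0 ≤ ng) :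
    p ≤ c * Real.exp (-(δ * (D' + B₁ + B₁'))) * nf * ng := by
  refine hp.trans (mul_le_mul_of_nonneg_right (mul_le_mul_of_nonneg_right ?_ hf0) hg0)
  refine mul_le_mul_of_nonneg_left (Real.exp_le_exp.2 ?_) hc0
  have : δ * (D' + B₁ + B₁') ≤ δ * (D + B + B') := mul_le_mul_of_nonneg_left (by linarith) hδ0
  linarith

end Main

/-! ### the bounds at one instance, with the instance's constants -/

section Instance

variable {ℓ : ℕ} {amin aplus m2plus : ℝ} (i : RegionPairInst d ℓ amin aplus m2plus) (F : OrthFlow ι)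
  {ℓ₁ : ℝ} (hℓ₁ : 0 ≤ ℓ₁)
  (hLip : ∀ t (v : ι → ℝ), ((F.U t - 1) *ᵥ v) ⬝ᵥ ((F.U t - 1) *ᵥ v) ≤ (ℓ₁ * t) ^ 2 * (v ⬝ᵥ v))
  (he : 0 < i.e) (ha : 0 < B1.aSeq i.a ((ℓ : ℝ) + 1) i.k) {creg β : ℝ} (hcreg : 0 ≤ creg)
  (h17 : ∀ x ∈ fineDom ((ℓ + 1) ^ i.k) i.Ω₀c, ∀ μ ν : Fin (d + 1),
    |i.Ac (x + e1 μ) ν - i.Ac x ν| ≤ creg * i.e ^ (β - 1) / ((ℓ + 1) ^ i.k : ℕ))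
  (hsmall : ℓ₁ ^ 2 * ((d + 1) * creg * i.e ^ β) ^ 2 * (d + 1) * (1 + B1.aSeq i.a ((ℓ : ℝ) + 1) i.k * (d + 1))
    ≤ min 2 (B1.aSeq i.a ((ℓ : ℝ) + 1) i.k) / 4)

/-- the four cases of `m`. [folklore] -/
private theorem fin4_cases (m : Fin 4) : m = 0 ∨ m = 1 ∨ m = 2 ∨ m = 3 := by
  fin_cases m <;> simp

include hℓ₁ hLip he ha hcreg h17 hsmall in
/-- **THE `G` PAIRINGS AT ONE INSTANCE** with the instance's constants: `|⟨f, X_m f′⟩| ≤ c0R(a_k)e^{−δ₀(d,a_k)dist(supp f,supp f′)}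
‖f‖₂‖f′‖₂` (b04's `cor23_main_region` on `Ω`, the family's distance below b04's). [cite: Balaban1983RegularityDecay, Cor. 2.3 (2.30) p.580] -/
theorem pair_bound_inst (m : Fin 4) (μ ν : Fin (d + 1)) (f f' : ↥(fineDom ((ℓ + 1) ^ i.k) i.Ωc) × ι → ℝ) :
    |f ⬝ᵥ i.opX F m μ ν f'| ≤ c0R (B1.aSeq i.a ((ℓ : ℝ) + 1) i.k)
      * Real.exp (-(delta0R d (B1.aSeq i.a ((ℓ : ℝ) + 1) i.k) * i.ssdist f f')) * bl2n f * bl2n f' := by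
  have h17Ω : ∀ x ∈ fineDom ((ℓ + 1) ^ i.k) i.Ωc, ∀ μ ν : Fin (d + 1),
      |i.Ac (x + e1 μ) ν - i.Ac x ν| ≤ creg * i.e ^ (β - 1) / ((ℓ + 1) ^ i.k : ℕ) :=
    fun x hx => h17 x (hfine i hx)
  obtain ⟨m0, m1, m2', m3⟩ :=
    cor23_main_region F hℓ₁ hLip he (one_le_n i) ha i.hm1 i.Ωc hcreg h17Ω hsmall f f' μ ν
  have hcR0 : 0 ≤ c0R (B1.aSeq i.a ((ℓ : ℝ) + 1) i.k) := (c0R_pos ha).le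
  have hδR0 : 0 ≤ delta0R d (B1.aSeq i.a ((ℓ : ℝ) + 1) i.k) := (delta0R_pos d ha).le
  have hfin : ∀ {p : ℝ}, p ≤ c0R (B1.aSeq i.a ((ℓ : ℝ) + 1) i.k)
      * Real.exp (-(delta0R d (B1.aSeq i.a ((ℓ : ℝ) + 1) i.k)
        * bsuppDist ((ℓ + 1) ^ i.k) (fineDom ((ℓ + 1) ^ i.k) i.Ωc) f f')) * bl2n f * bl2n f' →
      p ≤ c0R (B1.aSeq i.a ((ℓ : ℝ) + 1) i.k)
        * Real.exp (-(delta0R d (B1.aSeq i.a ((ℓ : ℝ) + 1) i.k) * i.ssdist f f')) * bl2n f * bl2n f' :=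
    fun hp => weak4 hp hcR0 le_rfl hδR0 le_rfl (ssdist_nonneg i f f') (ssdist_le_bsuppDist i f f')
      (bl2n_nonneg f) (bl2n_nonneg f')
  rcases fin4_cases m with rfl | rfl | rfl | rfl
  · rw [opX_zero]; exact hfin m0
  · rw [opX_one]; exact hfin m1
  · rw [opX_two]; exact hfin m2'
  · rw [opX_three]; exact hfin m3

omit [DecidableEq ι] in
include ha in
/-- **A CORRECTION AT ONE INSTANCE, IN THE JOINT-EXPONENT SHAPE**: a bound `p ≤ c0R e^{−δ(Σ/2 − 1)}‖Eu‖₂‖Ev‖₂` with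
`‖u‖₂ ≤ ‖f‖₂`, `‖v‖₂ ≤ ‖f′‖₂` gives `p ≤ 3c0R e^{−(δ/2)Σ}‖f‖₂‖f′‖₂` (`δ ≤ 1/8`). [cite: Balaban1983RegularityDecay, Cor. 2.3 p.581 (δG clause), constants] -/
theorem corr_shape {p : ℝ} {f f' u v : ↥(fineDom ((ℓ + 1) ^ i.k) i.Ωc) × ι → ℝ}
    (hp : p ≤ c0R (B1.aSeq i.a ((ℓ : ℝ) + 1) i.k)
      * Real.exp (-(delta0R d (B1.aSeq i.a ((ℓ : ℝ) + 1) i.k) * ((i.ssdist f f' + i.bdistS f + i.bdistS f') / 2 - 1)))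
      * bl2n (extV (fineDom ((ℓ + 1) ^ i.k) i.Ω₀c) u) * bl2n (extV (fineDom ((ℓ + 1) ^ i.k) i.Ω₀c) v))
    (hu : bl2n u ≤ bl2n f) (hv : bl2n v ≤ bl2n f') :
    p ≤ 3 * c0R (B1.aSeq i.a ((ℓ : ℝ) + 1) i.k)
      * Real.exp (-(delta0R d (B1.aSeq i.a ((ℓ : ℝ) + 1) i.k) / 2 * (i.ssdist f f' + i.bdistS f + i.bdistS f')))
      * bl2n f * bl2n f' := by
  have hcR0 : 0 ≤ c0R (B1.aSeq i.a ((ℓ : ℝ) + 1) i.k) := (c0R_pos ha).le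
  have hexpδ : Real.exp (delta0R d (B1.aSeq i.a ((ℓ : ℝ) + 1) i.k)) ≤ 3 :=
    (Real.exp_le_exp.2 (delta0R_le d ha)).trans exp_eighth_le_three
  rw [bl2n_extV (hfine i), bl2n_extV (hfine i)] at hp
  have hexp : Real.exp (-(delta0R d (B1.aSeq i.a ((ℓ : ℝ) + 1) i.k)
        * ((i.ssdist f f' + i.bdistS f + i.bdistS f') / 2 - 1)))
      = Real.exp (delta0R d (B1.aSeq i.a ((ℓ : ℝ) + 1) i.k))
        * Real.exp (-(delta0R d (B1.aSeq i.a ((ℓ : ℝ) + 1) i.k) / 2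
          * (i.ssdist f f' + i.bdistS f + i.bdistS f'))) := by
    rw [← Real.exp_add]; congr 1; ring
  rw [hexp] at hp
  set Y := Real.exp (-(delta0R d (B1.aSeq i.a ((ℓ : ℝ) + 1) i.k) / 2
    * (i.ssdist f f' + i.bdistS f + i.bdistS f'))) with hY
  have hY0 : 0 ≤ Y := (Real.exp_pos _).le
  calc p ≤ c0R (B1.aSeq i.a ((ℓ : ℝ) + 1) i.k) * (Real.exp (delta0R d (B1.aSeq i.a ((ℓ : ℝ) + 1) i.k)) * Y)
        * bl2n u * bl2n v := hp
    _ ≤ c0R (B1.aSeq i.a ((ℓ : ℝ) + 1) i.k) * (3 * Y) * bl2n f * bl2n f' :=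
        mul_le_mul (mul_le_mul (mul_le_mul_of_nonneg_left (mul_le_mul_of_nonneg_right hexpδ hY0) hcR0) hu
          (bl2n_nonneg u) (mul_nonneg hcR0 (by positivity))) hv (bl2n_nonneg v)
          (mul_nonneg (mul_nonneg hcR0 (by positivity)) (bl2n_nonneg f))
    _ = _ := by ring

include hℓ₁ hLip he ha hcreg h17 hsmall in
/-- **THE `δG` PAIRINGS AT ONE INSTANCE** with the instance's constants, in the joint-exponent shape:
`|⟨f, X^Ω_m f′ − (X^{Ω₀}_m Ef′)|_Ω⟩| ≤ (c1R(d,a_k) + 6c0R(a_k))e^{−(δ₀(d,a_k)/2)(dist(supp f,supp f′) + dist(supp f,Ω^c) +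
dist(supp f′,Ω^c))}‖f‖₂‖f′‖₂` (b04's `dcor23_main_region` + the boundary-layer corrections of §§3–4). [cite: Balaban1983RegularityDecay, Cor. 2.3 p.581 (δG clause)] -/
theorem dpair_bound_inst (m : Fin 4) (μ ν : Fin (d + 1)) (f f' : ↥(fineDom ((ℓ + 1) ^ i.k) i.Ωc) × ι → ℝ) :
    |f ⬝ᵥ (i.opX F m μ ν f' - i.resR (i.opX₀ F m μ ν (i.extR f')))|
      ≤ (c1R d (B1.aSeq i.a ((ℓ : ℝ) + 1) i.k) + 6 * c0R (B1.aSeq i.a ((ℓ : ℝ) + 1) i.k))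
        * Real.exp (-(delta0R d (B1.aSeq i.a ((ℓ : ℝ) + 1) i.k) / 2
          * (i.ssdist f f' + i.bdistS f + i.bdistS f'))) * bl2n f * bl2n f' := by
  have hcR0 : 0 ≤ c0R (B1.aSeq i.a ((ℓ : ℝ) + 1) i.k) := (c0R_pos ha).le
  have hc1R0 : 0 ≤ c1R d (B1.aSeq i.a ((ℓ : ℝ) + 1) i.k) := by
    have := two_c0R_le_c1R d ha; linarith
  have hδR0 : 0 ≤ delta0R d (B1.aSeq i.a ((ℓ : ℝ) + 1) i.k) := (delta0R_pos d ha).le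
  have hF : 0 ≤ bl2n f := bl2n_nonneg f
  have hF' : 0 ≤ bl2n f' := bl2n_nonneg f'
  set Y := Real.exp (-(delta0R d (B1.aSeq i.a ((ℓ : ℝ) + 1) i.k) / 2
    * (i.ssdist f f' + i.bdistS f + i.bdistS f'))) * bl2n f * bl2n f' with hY
  have hY0 : 0 ≤ Y := mul_nonneg (mul_nonneg (Real.exp_pos _).le hF) hF'
  have hgoal : ∀ {p : ℝ}, p ≤ c1R d (B1.aSeq i.a ((ℓ : ℝ) + 1) i.k) * Y
        + 2 * (3 * c0R (B1.aSeq i.a ((ℓ : ℝ) + 1) i.k) * Y) →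
      p ≤ (c1R d (B1.aSeq i.a ((ℓ : ℝ) + 1) i.k) + 6 * c0R (B1.aSeq i.a ((ℓ : ℝ) + 1) i.k))
        * Real.exp (-(delta0R d (B1.aSeq i.a ((ℓ : ℝ) + 1) i.k) / 2
          * (i.ssdist f f' + i.bdistS f + i.bdistS f'))) * bl2n f * bl2n f' := by
    intro p hp; rw [hY] at hp; linarith
  have h3Y : 0 ≤ 3 * c0R (B1.aSeq i.a ((ℓ : ℝ) + 1) i.k) * Y := mul_nonneg (mul_nonneg (by norm_num) hcR0) hY0
  have h1Y : 0 ≤ c1R d (B1.aSeq i.a ((ℓ : ℝ) + 1) i.k) * Y := mul_nonneg hc1R0 hY0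
  have hone : c1R d (B1.aSeq i.a ((ℓ : ℝ) + 1) i.k) * Y + 3 * c0R (B1.aSeq i.a ((ℓ : ℝ) + 1) i.k) * Y
      ≤ c1R d (B1.aSeq i.a ((ℓ : ℝ) + 1) i.k) * Y + 2 * (3 * c0R (B1.aSeq i.a ((ℓ : ℝ) + 1) i.k) * Y) := by
    linarith
  have htwo : c1R d (B1.aSeq i.a ((ℓ : ℝ) + 1) i.k) * Y + 3 * c0R (B1.aSeq i.a ((ℓ : ℝ) + 1) i.k) * Y
        + 3 * c0R (B1.aSeq i.a ((ℓ : ℝ) + 1) i.k) * Y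
      = c1R d (B1.aSeq i.a ((ℓ : ℝ) + 1) i.k) * Y + 2 * (3 * c0R (B1.aSeq i.a ((ℓ : ℝ) + 1) i.k) * Y) := by
    ring
  by_cases hout : (outR (fineDom ((ℓ + 1) ^ i.k) i.Ωc) (fineDom ((ℓ + 1) ^ i.k) i.Ω₀c)).Nonempty
  swap
  · -- `Ω₀ = Ω`: the pairings vanish
    have hEq : i.Ω₀c = i.Ωc := labels_eq_of_outR_empty (one_le_n i) i.hsub hout
    rw [dpair_eq_zero_of_eq i F hEq m μ ν f f', abs_zero]
    exact hgoal (by linarith)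
  -- the main terms (b04's reading), weakened to the family's distances
  have hsD := ssdist_le_bsuppDist i f f'
  have hbV := bdistS_le_bdistV i f hout
  have hbV' := bdistS_le_bdistV i f' hout
  obtain ⟨e0, e1', e2, e3⟩ :=
    dcor23_main_region F hℓ₁ hLip he (one_le_n i) ha i.hm1 i.hsub hcreg h17 hsmall f f' μ ν
  have hmain : ∀ {p : ℝ}, p ≤ c1R d (B1.aSeq i.a ((ℓ : ℝ) + 1) i.k)
      * Real.exp (-(delta0R d (B1.aSeq i.a ((ℓ : ℝ) + 1) i.k) / 2
        * (bsuppDist ((ℓ + 1) ^ i.k) (fineDom ((ℓ + 1) ^ i.k) i.Ωc) f f'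
          + bdistV ((ℓ + 1) ^ i.k) (hfine i) f + bdistV ((ℓ + 1) ^ i.k) (hfine i) f'))) * bl2n f * bl2n f' →
      p ≤ c1R d (B1.aSeq i.a ((ℓ : ℝ) + 1) i.k) * Y := by
    intro p hp
    have h := weak3 hp hc1R0 (div_nonneg hδR0 zero_le_two) hsD hbV hbV' hF hF'
    simpa only [hY, mul_assoc] using h
  have hcorr : ∀ {p : ℝ} {u v : ↥(fineDom ((ℓ + 1) ^ i.k) i.Ωc) × ι → ℝ},
      p ≤ c0R (B1.aSeq i.a ((ℓ : ℝ) + 1) i.k)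
        * Real.exp (-(delta0R d (B1.aSeq i.a ((ℓ : ℝ) + 1) i.k)
          * ((i.ssdist f f' + i.bdistS f + i.bdistS f') / 2 - 1)))
        * bl2n (extV (fineDom ((ℓ + 1) ^ i.k) i.Ω₀c) u) * bl2n (extV (fineDom ((ℓ + 1) ^ i.k) i.Ω₀c) v) →
      bl2n u ≤ bl2n f → bl2n v ≤ bl2n f' → p ≤ 3 * c0R (B1.aSeq i.a ((ℓ : ℝ) + 1) i.k) * Y := by
    intro p u v hp hu hv
    have h := corr_shape i ha hp hu hv
    simpa only [hY, mul_assoc] using h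
  -- norms and supports of the localised parts
  have honL : ∀ (μ' : Fin (d + 1)) (g : ↥(fineDom ((ℓ + 1) ^ i.k) i.Ωc) × ι → ℝ),
      bl2n ((g - offL (fineDom ((ℓ + 1) ^ i.k) i.Ω₀c) μ' g)) ≤ bl2n g :=
    fun μ' g => bl2n_le_of_dot_le (sub_offL_dot_self_le μ' g)
  have hoffL : ∀ (μ' : Fin (d + 1)) (g : ↥(fineDom ((ℓ + 1) ^ i.k) i.Ωc) × ι → ℝ),
      bl2n (offL (fineDom ((ℓ + 1) ^ i.k) i.Ω₀c) μ' g) ≤ bl2n g :=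
    fun μ' g => bl2n_le_of_dot_le (offL_dot_self_le μ' g)
  have hon_f : ∀ (μ' : Fin (d + 1)) (g : ↥(fineDom ((ℓ + 1) ^ i.k) i.Ωc) × ι → ℝ) p,
      (g - offL (fineDom ((ℓ + 1) ^ i.k) i.Ω₀c) μ' g) p ≠ 0 → g p ≠ 0 := fun μ' g p h => (of_sub_offL_ne h).1
  have hon_loc : ∀ (μ' : Fin (d + 1)) (g : ↥(fineDom ((ℓ + 1) ^ i.k) i.Ωc) × ι → ℝ) p,
      (g - offL (fineDom ((ℓ + 1) ^ i.k) i.Ω₀c) μ' g) p ≠ 0 → p.1.1 + e1 μ' ∉ fineDom ((ℓ + 1) ^ i.k) i.Ωc :=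
    fun μ' g p h => (of_sub_offL_ne h).2.2
  have hoff_f : ∀ (μ' : Fin (d + 1)) (g : ↥(fineDom ((ℓ + 1) ^ i.k) i.Ωc) × ι → ℝ) p,
      offL (fineDom ((ℓ + 1) ^ i.k) i.Ω₀c) μ' g p ≠ 0 → g p ≠ 0 := fun μ' g p h => of_offL_ne h
  rcases fin4_cases m with rfl | rfl | rfl | rfl
  · -- `m = 0`: no correction
    rw [dpair_zero_eq]
    have hM : |f ⬝ᵥ dGv (hfine i) (i.GΩ F) (i.G₀ F) f'| ≤ c1R d (B1.aSeq i.a ((ℓ : ℝ) + 1) i.k) * Y := hmain e0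
    exact hgoal (hM.trans (by linarith))
  · -- `m = 1`
    rw [dpair_one_eq]
    have hM : |f ⬝ᵥ (i.DΩ F μ *ᵥ dGv (hfine i) (i.GΩ F) (i.G₀ F) f')| ≤ c1R d (B1.aSeq i.a ((ℓ : ℝ) + 1) i.k) * Y :=
      hmain e1'
    obtain ⟨-, c1, -, -⟩ := corr_bound i F hℓ₁ hLip he ha hcreg h17 hsmall μ ν μ ν f f'
      ((f - offL (fineDom ((ℓ + 1) ^ i.k) i.Ω₀c) μ f)) f' (hon_f μ f) (fun _ h => h) (Or.inl (hon_loc μ f))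
    have hc1' := hcorr c1 (honL μ f) le_rfl
    exact hgoal ((abs_sub _ _).trans ((add_le_add hM hc1').trans hone))
  · -- `m = 2`
    rw [dpair_two_eq]
    have hM : |f ⬝ᵥ dGv (hfine i) (i.GΩ F) (i.G₀ F) ((i.DΩ F ν)ᵀ *ᵥ f')|
        ≤ c1R d (B1.aSeq i.a ((ℓ : ℝ) + 1) i.k) * Y := hmain e2
    obtain ⟨-, -, c2, -⟩ := corr_bound i F hℓ₁ hLip he ha hcreg h17 hsmall μ ν μ ν f f'
      f ((f' - offL (fineDom ((ℓ + 1) ^ i.k) i.Ω₀c) ν f')) (fun _ h => h) (hon_f ν f') (Or.inr (hon_loc ν f'))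
    have hc2' := hcorr c2 le_rfl (honL ν f')
    exact hgoal ((abs_sub _ _).trans ((add_le_add hM hc2').trans hone))
  · -- `m = 3`
    rw [dpair_three_eq]
    have hM : |f ⬝ᵥ (i.DΩ F μ *ᵥ dGv (hfine i) (i.GΩ F) (i.G₀ F) ((i.DΩ F ν)ᵀ *ᵥ f'))|
        ≤ c1R d (B1.aSeq i.a ((ℓ : ℝ) + 1) i.k) * Y := hmain e3
    obtain ⟨-, -, -, c3⟩ := corr_bound i F hℓ₁ hLip he ha hcreg h17 hsmall μ ν μ ν f f'
      ((f - offL (fineDom ((ℓ + 1) ^ i.k) i.Ω₀c) μ f)) f' (hon_f μ f) (fun _ h => h) (Or.inl (hon_loc μ f))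
    obtain ⟨-, -, -, c3'⟩ := corr_bound i F hℓ₁ hLip he ha hcreg h17 hsmall μ ν μ ν f f'
      (offL (fineDom ((ℓ + 1) ^ i.k) i.Ω₀c) μ f) ((f' - offL (fineDom ((ℓ + 1) ^ i.k) i.Ω₀c) ν f'))
      (hoff_f μ f) (hon_f ν f') (Or.inr (hon_loc ν f'))
    have hc3 := hcorr c3 (honL μ f) le_rfl
    have hc3' := hcorr c3' (hoffL μ f) (honL ν f')
    exact hgoal ((abs_sub _ _).trans ((add_le_add (abs_sub _ _) le_rfl).trans
      ((add_le_add (add_le_add hM hc3) hc3').trans htwo.le)))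

end Instance

/-! ### the typed Corollary on the family -/

section Family

/-- **[B4] COROLLARY 2.3 (2.30) AND ITS `δG` CLAUSE ON THE FAMILY OF GENERAL REGION PAIRS** — the typed
`B4.Cor23Printed` INHABITED on `regionPairFam F d ℓ a₋ a₊ m²₊ c β K`: for every orthogonal flow with a Lipschitz
generator, `L = ℓ+1 ≥ 2`, `a₋ > 0`, `c ≥ 0`, `β > 0` and every block size `K` THERE EXIST `c₀, δ₀, e₁ > 0` such that for
EVERY instance — every scale `k ≥ 1`, every nested pair `Ω ⊆ Ω₀` of finite unions of blocks, every `a ∈ [a₋,a₊]`,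
`m² ∈ [0,m²₊]`, every component field `A` with (1.7) on `Ω₀`, every coupling `0 < e ≤ e₁` — the four pairings of (2.30)
are `≤ c₀e^{−δ₀dist(supp f,supp f′)}‖f‖₂‖f′‖₂` and the four `δG` pairings carry the additional factor
`e^{−δ₀(dist(supp f,Ω^c) + dist(supp f′,Ω^c))}`, for ALL `f, f′` (no support restriction).  Constants:
`c₀ = c1W(d,¾a₋,a₂) + 6c0R(¾a₋)`, `δ₀ = dW(d,¾a₋,a₂)`, `a₂ = max(a₊,¾a₋)`. [cite: Balaban1983RegularityDecay, Cor. 2.3 (2.30) pp.580–581; Theorem p.573 «constants … independent of A, k, Ω»; (1.7) pp.572–573] -/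
theorem cor23Printed_regionPairFam (F : OrthFlow ι) {ℓ₁ : ℝ} (hℓ₁ : 0 ≤ ℓ₁)
    (hLip : ∀ t (v : ι → ℝ), ((F.U t - 1) *ᵥ v) ⬝ᵥ ((F.U t - 1) *ᵥ v) ≤ (ℓ₁ * t) ^ 2 * (v ⬝ᵥ v))
    (d ℓ : ℕ) (hℓ : 1 ≤ ℓ) (amin aplus m2plus : ℝ) (ha : 0 < amin) (creg β : ℝ) (hcreg : 0 ≤ creg)
    (hβ : 0 < β) (K : ℕ) :
    Cor23Printed (regionPairFam F d ℓ amin aplus m2plus creg β K) := by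
  -- the window of the running coefficient and the constants
  set a₁ : ℝ := 3 / 4 * amin with ha₁
  set a₂ : ℝ := max aplus a₁ with ha₂
  have ha₁0 : 0 < a₁ := by rw [ha₁]; positivity
  have h12 : a₁ ≤ a₂ := le_max_right _ _
  obtain ⟨e₁, he₁, hsm⟩ := threshold_window ℓ₁ ((d + 1) * creg) ha₁0 h12 hβ d
  have hc0 : 0 < c0R a₁ := c0R_pos ha₁0
  have hc1 : c0R a₁ ≤ c1W d a₁ a₂ := c0R_le_c1W d ha₁0 le_rfl
  refine ⟨c1W d a₁ a₂ + 6 * c0R a₁, dW d a₁ a₂, e₁, by linarith, dW_pos d ha₁0 h12, he₁, ?_⟩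
  intro i hreg _hbig he hle m μ ν f f'
  -- the instance: running coefficient, smallness, regularity
  dsimp only [regionPairFam] at hreg he hle ⊢
  obtain ⟨hak1, hak2⟩ := B4CubeFieldHyps22.aSeq_window hℓ i.hk ha i.ha1 i.ha2
  have hak2' : B1.aSeq i.a ((ℓ : ℝ) + 1) i.k ≤ a₂ := hak2.trans (le_max_left _ _)
  have hak : 0 < B1.aSeq i.a ((ℓ : ℝ) + 1) i.k := ha₁0.trans_le hak1
  have hsmall : ℓ₁ ^ 2 * ((d + 1) * creg * i.e ^ β) ^ 2 * (d + 1)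
      * (1 + B1.aSeq i.a ((ℓ : ℝ) + 1) i.k * (d + 1)) ≤ min 2 (B1.aSeq i.a ((ℓ : ℝ) + 1) i.k) / 4 := by
    have := hsm i.e he hle _ hak1 hak2'
    simpa only [mul_assoc] using this
  -- constants of the instance versus the window constants
  have hcR : c0R (B1.aSeq i.a ((ℓ : ℝ) + 1) i.k) ≤ c0R a₁ := c0R_anti ha₁0 hak1
  have hcR0 : 0 ≤ c0R (B1.aSeq i.a ((ℓ : ℝ) + 1) i.k) := (c0R_pos hak).le
  have hc1R : c1R d (B1.aSeq i.a ((ℓ : ℝ) + 1) i.k) ≤ c1W d a₁ a₂ := c1R_window d ha₁0 hak1 hak2'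
  have hc1R0 : 0 ≤ c1R d (B1.aSeq i.a ((ℓ : ℝ) + 1) i.k) := by
    have := two_c0R_le_c1R d hak; linarith
  have hδW : dW d a₁ a₂ ≤ delta0R d (B1.aSeq i.a ((ℓ : ℝ) + 1) i.k) / 2 := dW_le d ha₁0 hak1 hak2'
  have hδW0 : 0 ≤ dW d a₁ a₂ := (dW_pos d ha₁0 h12).le
  have hδR0 : 0 ≤ delta0R d (B1.aSeq i.a ((ℓ : ℝ) + 1) i.k) := (delta0R_pos d hak).le
  have hδW' : dW d a₁ a₂ ≤ delta0R d (B1.aSeq i.a ((ℓ : ℝ) + 1) i.k) := by linarith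
  -- norms and distances
  have hs0 := ssdist_nonneg i f f'
  have hb0 := i.bdistS_nonneg f
  have hb0' := i.bdistS_nonneg f'
  have hF : 0 ≤ bl2n f := bl2n_nonneg f
  have hF' : 0 ≤ bl2n f' := bl2n_nonneg f'
  rw [l2_eq_bl2n, l2_eq_bl2n]
  constructor
  · exact weak4 (pair_bound_inst i F hℓ₁ hLip he hak hcreg hreg hsmall m μ ν f f') hcR0 (by linarith) hδW0 hδW'
      hs0 le_rfl hF hF'
  · exact weak5 (dpair_bound_inst i F hℓ₁ hLip he hak hcreg hreg hsmall m μ ν f f') (by linarith) (by linarith)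
      hδW0 hδW hs0 le_rfl hb0 le_rfl hb0' le_rfl hF le_rfl hF' le_rfl

end Family

end

end Literature.MathematicalPhysics.QuantumFieldTheory.Balaban1983to89.B4Cor23RegionPairFam
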